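import Summits.BirchSwinnertonDyer.BirchSwinnertonDyer.Theses.KolyvaginRankRigidityAtTwo
import Summits.BirchSwinnertonDyer.BirchSwinnertonDyer.Theorems.KolyvaginRankRigidityAtTwoChebotarevWindowPrimeAtTwo
import Summits.BirchSwinnertonDyer.BirchSwinnertonDyer.Theorems.KolyvaginRankRigidityAtTwoWalkStepTransfer
import Summits.BirchSwinnertonDyer.BirchSwinnertonDyer.Theorems.KolyvaginRankRigidityAtTwoSwapFromPiecesPrelims
import Summits.BirchSwinnertonDyer.BirchSwinnertonDyer.Theorems.Rank1ResidualJetCompatibleData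
import Summits.BirchSwinnertonDyer.BirchSwinnertonDyer.Theorems.Rank1ResidualJetRingClassFields
import Summits.BirchSwinnertonDyer.BirchSwinnertonDyer.Theorems.ByReductionTypeAtTwoRankOneAtTwoOffBigImageOddLocalEngineEndToEnd
import Literature.NumberTheory.EllipticCurves.Jetchev2008.CoreVertices
import Summits.BirchSwinnertonDyer.BirchSwinnertonDyer.Theorems.KolyvaginRankRigidityAtTwoRegularCoreSupplyAtTwoRegularConductors
import Summits.BirchSwinnertonDyer.BirchSwinnertonDyer.Theorems.KolyvaginRankRigidityAtTwoWalkNearCore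
import Summits.BirchSwinnertonDyer.BirchSwinnertonDyer.Theorems.KolyvaginRankRigidityAtTwoStartFrameOfParity
import Summits.BirchSwinnertonDyer.BirchSwinnertonDyer.Theorems.KolyvaginRankRigidityAtTwoStartFrameNearCoreHolds
import Summits.BirchSwinnertonDyer.BirchSwinnertonDyer.Theorems.GenusKolyvaginAtTwoKolyvaginRelationAtTwo
import Summits.BirchSwinnertonDyer.BirchSwinnertonDyer.Theorems.GenusKolyvaginAtTwoVisiblePairAtTwoKolyvaginClassSign
import HarnessLib
import Summits.BirchSwinnertonDyer.BirchSwinnertonDyer.Theorems.GenusKolyvaginAtTwoPowDvdShaCardAtTwoRTKolyvaginClassOrder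
import Summits.BirchSwinnertonDyer.BirchSwinnertonDyer.Theorems.KolyvaginRoadThreeLevelData
import Summits.BirchSwinnertonDyer.Rank1Residual.X11b.Three.KolyvaginNonvanishing
import Literature.NumberTheory.EllipticCurves.HeegnerPointsOfConductorRationalityProofs
import Literature.NumberTheory.EllipticCurves.RingClassGalOverCyclicProofs

set_option linter.dupNamespace false

/-!
# LINE 17 support — EV of the REGISTERED skeleton v7.2r, PROVED (pen bsd-idea-1 g15, 2026-08-29)

`SingularToVisibleAtTwoV72r` below is the statement of `SingularToVisibleAtTwo` copied byte-for-byte from the file of record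
`Cruxes/KolyvaginBoundedDefectAtTwo/Lines/kolyvagin_swap.lean` (sha16 399f58a6, l.392–399; registered by the LEAD, W-79 — this file does not touch
it).  It asks only `M ≤ M(q)` (no margin), so the packaged Φ-KILL (`RegularRefill.localization_eq_zero_of_forall_h1Eval_eq_zero`, index `≥ k+1`)
does not apply verbatim; the same ten lines at the SAME level do: `Γ_{K_w}` fixes `E[2^M]` at a Kolyvagin prime of index `≥ M`
(`JET.GlobalDuality.galoisRep_toLocal_apply_eq_self`), so a cocycle vanishing on `Γ_{K(E[2^M])}` restricts to zero on `Γ_{K_w}`.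
Helper for the LEAD `cruxlead-stmt-BirchSwinnertonDyer-28083` (stub `stub_singularToVisibleAtTwo`): paste `singularToVisibleAtTwoV72r_holds`'s proof.
THEOREMS ONLY; nothing here proves SWα, U1, a rung or BSD.  BSD is NOT proved.
-/

namespace Summit.BirchSwinnertonDyer.BirchSwinnertonDyer.Cruxes.KolyvaginBoundedDefectAtTwo.KolyvaginSwap.EVSupport

open scoped Classical
open WeierstrassCurve NumberField IsDedekindDomain Field
open Literature.NumberTheory.GaloisRepresentations Literature.NumberTheory.EllipticCurves
open Literature.NumberTheory
open Rat.HeightOneSpectrum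
open Summit.BirchSwinnertonDyer.Rank1Residual.X11b
open Summit.BirchSwinnertonDyer.BirchSwinnertonDyer.Theorems
open Summit.BirchSwinnertonDyer.BirchSwinnertonDyer.Theses.KolyvaginRankRigidityAtTwo
open Literature.NumberTheory.EllipticCurves.Jetchev2008 Literature.NumberTheory.EllipticCurves.KolyvaginPairing
open Literature.NumberTheory.GaloisCohomology
open Summit.BirchSwinnertonDyer.Rank1Residual
open Summit.BirchSwinnertonDyer.Rank1Residual.JET.SelmerVocabulary
open Summit.BirchSwinnertonDyer.Rank1Residual.JET.GlobalDuality (galoisRep_toLocal_apply_eq_self)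

/-- **Φ-KILL at the same level.** `K` imaginary quadratic, `ℓ` a Zhang–Kolyvagin prime at `2` of index `≥ k`, `v ∋ ℓ`: a class of
`H¹(K, E[2^k])` whose cocycle vanishes on `Γ_{K(E[2^k])}` is locally trivial at `v` (`Γ_{K_v}` fixes `E[2^k]`).
[cite: McCallumLMS1991, Prop. 4.4 (proof)] [cite: GrossLMS1991, §9] -/
theorem localization_eq_zero_of_forall_h1Eval_eq_zero_sameLevel {K : Type} [Field K] [NumberField K]
    (W : WeierstrassCurve ℚ) [W.IsElliptic] [W.IsGloballyMinimal] (hK : IsImaginaryQuadratic K) {k ℓ : ℕ}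
    (hℓ : Zhang2014.IsKolyvaginPrime (W.conductorNorm ℤ) W K 2 ℓ) (hk : k ≤ Zhang2014.kolyvaginIndex W 2 ℓ)
    (v : HeightOneSpectrum (𝓞 K)) (hv : (ℓ : 𝓞 K) ∈ v.asIdeal)
    {x : galH1Torsion (W.baseChange K) ((2 ^ k : ℕ) : ℤ)}
    (hx : ∀ ρ ∈ torsionFixing (W.baseChange K) ((2 ^ k : ℕ) : ℤ),
      h1Eval (W.baseChange K) ((2 ^ k : ℕ) : ℤ) x ρ = 0) :
    galoisCohomology.localization ((W.baseChange K).torsionGaloisModule ((2 ^ k : ℕ) : ℤ)) (Sum.inr v : Place K) 1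
      x = 0 := by
  haveI : Fact (Nat.Prime 2) := ⟨Nat.prime_two⟩
  apply Summit.BirchSwinnertonDyer.Rank1Residual.X11b.KolyvaginReciprocity.localization_eq_zero_of_mem_torsionLocalKer (W.baseChange K)
    (n := ((2 ^ k : ℕ) : ℤ)) (by positivity) v
  rw [← oneCocycleClass_reprCocycle (W.baseChange K) ((2 ^ k : ℕ) : ℤ) x]
  change oneCocycleClass _ _ ∈ resKer (resGal (K := K) (v.adicCompletion K))
    (torsionPointsMap (W.baseChange K) (v.adicCompletion K) ((2 ^ k : ℕ) : ℤ))
    (torsionPointsMap_smul (W.baseChange K) (v.adicCompletion K) ((2 ^ k : ℕ) : ℤ))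
  rw [oneCocycleClass_mem_resKer_iff]
  refine ⟨0, fun σ ↦ ?_⟩
  have hmem : resGal (K := K) (v.adicCompletion K) σ ∈ torsionFixing (W.baseChange K) ((2 ^ k : ℕ) : ℤ) := by
    rw [mem_torsionFixing_iff]
    intro P
    exact galoisRep_toLocal_apply_eq_self W K hK hℓ hk v hv σ P
  have h0 : (reprCocycle (W.baseChange K) ((2 ^ k : ℕ) : ℤ) x).1 (resGal (K := K) (v.adicCompletion K) σ) = 0 :=
    hx _ hmem
  rw [h0, map_zero, smul_zero, sub_zero]

/-- Verbatim copy of the REGISTERED v7.2r stub statement `SingularToVisibleAtTwo` (Lines/kolyvagin_swap.lean l.392–399, sha16 399f58a6). -/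
def SingularToVisibleAtTwoV72r : Prop :=
  ∀ (W : WeierstrassCurve ℚ) [W.IsElliptic] [W.IsGloballyMinimal], ¬ W.HasCM → (Literature.NumberTheory.EllipticCurves.Rank1Residual.GoodOrd W 2 ∨ Literature.NumberTheory.EllipticCurves.Rank1Residual.Mult W 2) → (∀ m : ℕ, W.HasSurjectiveModNGaloisRep (2 ^ m : ℕ)) → ∀ (K : Type) [Field K] [NumberField K], Literature.NumberTheory.EllipticCurves.IsImaginaryQuadratic K → ∀ [NeZero (W.conductorNorm ℤ)], Literature.NumberTheory.EllipticCurves.SatisfiesHeegnerHypothesis (W.conductorNorm ℤ) K → Odd (NumberField.discr K) → NumberField.discr K ≠ -3 → AddSubgroup.torsionBy (W.baseChange K).toAffine.Point (2 : ℤ) = ⊥ → Literature.NumberTheory.EllipticCurves.SatisfiesHeegnerHypothesis 2 K → ∀ (Dt : Literature.NumberTheory.EllipticCurves.ModularForms.ModularParametrizationData W (W.conductorNorm ℤ)) (β : ℤ) (ι : K →+* ℂ) [∀ k : ℕ, NumberField (ringClassField K ι k)], (4 * (W.conductorNorm ℤ : ℤ)) ∣ β ^ 2 - NumberField.discr K 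→
    ∀ (M m q j : ℕ) (d : Literature.NumberTheory.EllipticCurves.KolyvaginHeegnerData Dt β ι m), 1 ≤ M → Squarefree (m * q) → q.Prime → ¬ q ∣ m →
      (∀ l' ∈ (m * q).primeFactors, Literature.NumberTheory.EllipticCurves.Zhang2014.IsKolyvaginPrime (W.conductorNorm ℤ) W K 2 l' ∧ M ≤ Literature.NumberTheory.EllipticCurves.Zhang2014.kolyvaginIndex W 2 l') →
      ∀ (w : IsDedekindDomain.HeightOneSpectrum (NumberField.RingOfIntegers K)), (q : NumberField.RingOfIntegers K) ∈ w.asIdeal →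
      ((2 ^ j : ℕ) : ℤ) • d.kolyvaginClass Nat.prime_two M ∉ (W.baseChange K).torsionLocalKer (w.adicCompletion K) ((2 ^ M : ℕ) : ℤ) →
      ∃ ρ ∈ torsionFixing (W.baseChange K) ((2 ^ M : ℕ) : ℤ),
        ((2 ^ j : ℕ) : ℤ) • h1Eval (W.baseChange K) ((2 ^ M : ℕ) : ℤ) (d.kolyvaginClass Nat.prime_two M) ρ ≠ 0

/-- **EV (v7.2r statement) holds** — sorry-free.  `q ∈ (m·q).primeFactors` gives `q` Kolyvagin of index `≥ M`; if every `ρ ∈ Γ_{K(E[2^M])}` had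
`2^j·c_M(ρ) = 0` then `loc_w (2^j c_M) = 0` by Φ-KILL at the same level, contradicting the singular hypothesis. -/
theorem singularToVisibleAtTwoV72r_holds : SingularToVisibleAtTwoV72r := by
  intro W _ _ hCM hred hsurj K _ _ hK _ hH hodd hd3 htors hH2 Dt β ι _ hβ M m q j d hM hsq hq hqm hKol w hw hnot
  have hqmem : q ∈ (m * q).primeFactors :=
    Nat.mem_primeFactors.mpr ⟨hq, Dvd.intro_left m rfl, hsq.ne_zero⟩
  obtain ⟨hKolq, hidxq⟩ := hKol q hqmem
  by_contra! hvis
  apply hnot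
  rw [KolyvaginLowerBoundAtTwo.mem_torsionLocalKer_two_pow_iff W M w]
  refine localization_eq_zero_of_forall_h1Eval_eq_zero_sameLevel W hK hKolq hidxq w hw fun ρ hρ ↦ ?_
  rw [h1Eval_zsmul _ _ _ _ hρ]
  exact hvis ρ hρ

end Summit.BirchSwinnertonDyer.BirchSwinnertonDyer.Cruxes.KolyvaginBoundedDefectAtTwo.KolyvaginSwap.EVSupport
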